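import Literature.Computability.MetaComplexity.KtViaRuler
import HarnessLib

/-!
# Complexity meta: `K^t` upper bounds under a DOUBLY exponential ruler (budgets `T` at description cost `O(log log T)`)

Topic `Literature/Computability/MetaComplexity`, sequel of `KtViaRuler.lean`. The ruler device of
that file prints `g ⟨1^{2^ℓ} 0 u, payload⟩` from the program `⟨e, ⟨u, payload⟩⟩`, `|u| = ℓ`, so a
time budget `T ≤ 2^ℓ` made available to `g` in unary costs `2ℓ ≈ 2 log T` description bits. For
`K^t` bounds that must not depend on the time parameter `t` beyond `O(log log t)` — Hirahara's
Lemma 4.19 (FOCS 2018 / ECCC TR18-138, p. 21: "`K^T_{t₃}(x) ≤ K^{T_{t₁}}_{t₂}(x) + O(log log t₁)` …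
such that `t₁` is a power of `2`", used in the proof of Thm. 4.21 together with "we may assume
without loss of generality that `O(log log t₁) = O(log n)`") — the pad is applied TWICE: the
program `⟨e, ⟨u, payload⟩⟩` is expanded to `⟨1^{2^ℓ} 0 u, payload⟩` and then to
`⟨1^{2^{ℓ'}} 0 1^{2^ℓ} 0 u, payload⟩`, `ℓ' = 2^ℓ + ℓ + 1`, before `g` runs, so that `g` sees a ruler of
length `2^{ℓ'} ≥ 2^{2^ℓ}` while the description still has length `|payload| + 2ℓ + O(1)`:

* `UniversalMachine.exists_outputsWithin_ruler₂` — the machine (two exponential pads on the first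
  component, then `g`; per-input additive time, `Turing.TM2ComputableAux.comp_outputsWithin`);
* `UniversalMachine.exists_ktAt_le_of_FP₂` — **for every `g ∈ FP` there are `c₀` and a polynomial
  `q` with `K^{q(2^{|expPad 1 u|} + |payload|)}(g ⟨expPad 1 (expPad 1 u), payload⟩) ≤ |payload| + 2|u| + c₀`.**
* `expPad_one_expPad_one` — the shape of the double pad, `1^{2^{2^ℓ+ℓ+1}} 0 (1^{2^ℓ} 0 u)`.

## References

* S. Hirahara, *Non-black-box worst-case to average-case reductions within NP*, FOCS 2018; full
  version ECCC TR18-138 (rev. 1), Lemma 4.19 and proof of Thm. 4.21 (pp. 21–23).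
* M. Li, P. Vitányi, *An Introduction to Kolmogorov Complexity and Its Applications*, §7.1.
-/

namespace Literature.Computability.MetaComplexity

open _root_.Computability Complexity Polynomial Turing

/-- The double pad unfolds to a ruler of length `2^{2^ℓ + ℓ + 1}` followed by `0` and the single pad.
[folklore] -/
theorem expPad_one_expPad_one (u : List Bool) :
    expPad 1 (expPad 1 u) =
      List.replicate (2 ^ (2 ^ u.length + u.length + 1)) true ++ false :: expPad 1 u := by
  rw [expPad, pow_one, length_expPad, pow_one]

/-- Length of the single pad with exponent `1`: `2^ℓ + ℓ + 1`. [folklore] -/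
theorem length_expPad_one (u : List Bool) : (expPad 1 u).length = 2 ^ u.length + u.length + 1 := by
  rw [length_expPad, pow_one]

namespace UniversalMachine

variable (U : UniversalMachine)

/-- **The double ruler machine**: for `g ∈ FP` there is a TM2 machine which, on `⟨u, payload⟩`,
outputs `g ⟨expPad 1 (expPad 1 u), payload⟩` within `A · (2^{|expPad 1 u|} + |payload|)^B + A` steps
(the exponential pad of `Complexity/ExpPadding.lean` on the first component, then the single
ruler machine of `KtViaRuler.lean`; times add per input). [Hirahara 2018 (ECCC TR18-138),
Lemma 4.19 (proof: "simulate and output `U^{T_{t₁}}(d₀)` … given `log t₁ ∈ ℕ`")]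
[cite: Hirahara2018, Lemma 4.19 (proof)] -/
theorem exists_outputsWithin_ruler₂ {g : List Bool → List Bool} (hg : g ∈ FP) :
    ∃ (M : TM2ComputableAux Bool Bool) (A B : ℕ), ∀ u payload : List Bool,
      M.OutputsWithin (boolPair u payload) (g (boolPair (expPad 1 (expPad 1 u)) payload))
        (A * (2 ^ (expPad 1 u).length + payload.length) ^ B + A) := by
  obtain ⟨CE, ME, hME⟩ := exists_timeComputable_expPad (k := 1) le_rfl
  obtain ⟨M₁, A, B, hM₁⟩ := exists_outputsWithin_ruler hg
  refine ⟨(mapFstAux ME).comp M₁, A + (2 * CE + 25), B + 1, fun u payload => ?_⟩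
  set u' := expPad 1 u with hu'
  -- stage 1: the first pad on the first component
  have h1 : (mapFstAux ME).OutputsWithin (boolPair u payload) (boolPair u' payload)
      ((CE * 2 ^ (u.length ^ 1) + CE) + 3 * u'.length + 2 * (boolPair u payload).length + 6) := by
    have h := outputsWithin_mapFstAux ME (z := boolPair u payload) (out := u')
      (m := CE * 2 ^ (u.length ^ 1) + CE) (by simpa [hu'] using hME u)
    rwa [readRest_boolPair] at h
  -- stage 2: the single ruler machine on `⟨u', payload⟩`
  have h2 := hM₁ u' payload
  have h := TM2ComputableAux.comp_outputsWithin _ M₁ h1 h2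
  refine h.mono ?_
  -- bookkeeping in `Z = 2^{|u'|} + |payload|`
  set Z := 2 ^ u'.length + payload.length with hZ
  have hZ1 : 1 ≤ Z := le_add_right Nat.one_le_two_pow
  have hlenu' : u'.length = 2 ^ u.length + u.length + 1 := by rw [hu', length_expPad, pow_one]
  have h2pos : 1 ≤ 2 ^ u.length := Nat.one_le_two_pow
  have h2pos' : 1 ≤ 2 ^ u'.length := Nat.one_le_two_pow
  have hu'Z : u'.length ≤ Z := le_add_right (Nat.lt_two_pow_self).le
  have h2u : 2 ^ u.length ≤ u'.length := by rw [hlenu']; omega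
  have huu : u.length ≤ u'.length := by rw [hlenu']; omega
  have hpZ : payload.length ≤ Z := Nat.le_add_left _ _
  have hlenup : (boolPair u payload).length = 2 * u.length + 2 + payload.length := length_boolPair u payload
  have hrest : CE * 2 ^ (u.length ^ 1) + CE + 3 * u'.length + 2 * (boolPair u payload).length + 6 ≤
      (2 * CE + 25) * Z := by
    have hA : CE * 2 ^ u.length ≤ CE * Z := Nat.mul_le_mul_left CE (h2u.trans hu'Z)
    have hB : CE ≤ CE * Z := Nat.le_mul_of_pos_right CE hZ1
    rw [pow_one, hlenup]
    have : u.length ≤ Z := huu.trans hu'Z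
    calc CE * 2 ^ u.length + CE + 3 * u'.length + 2 * (2 * u.length + 2 + payload.length) + 6
        ≤ 2 * (CE * Z) + 25 * Z := by omega
      _ = (2 * CE + 25) * Z := by ring
  have hZB : Z ^ B ≤ Z ^ (B + 1) := Nat.pow_le_pow_right hZ1 (Nat.le_succ _)
  have hZ1B : Z ≤ Z ^ (B + 1) := by
    calc Z = Z ^ 1 := (pow_one Z).symm
      _ ≤ Z ^ (B + 1) := Nat.pow_le_pow_right hZ1 (Nat.le_add_left 1 _)
  calc A * Z ^ B + A + (CE * 2 ^ (u.length ^ 1) + CE + 3 * u'.length + 2 * (boolPair u payload).length + 6)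
      ≤ A * Z ^ B + A + (2 * CE + 25) * Z := Nat.add_le_add_left hrest _
    _ ≤ A * Z ^ (B + 1) + A + (2 * CE + 25) * Z ^ (B + 1) :=
        add_le_add (Nat.add_le_add_right (Nat.mul_le_mul_left _ hZB) _) (Nat.mul_le_mul_left _ hZ1B)
    _ ≤ (A + (2 * CE + 25)) * Z ^ (B + 1) + (A + (2 * CE + 25)) := by
        have : 0 ≤ (2 * CE + 25) := Nat.zero_le _
        nlinarith [Nat.zero_le (Z ^ (B + 1)), Nat.zero_le A]

/-- **`K^t` upper bound through a double ruler.** For every `g ∈ FP` there are a constant `c₀` and a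
polynomial `q` such that for all strings `u, payload`,
`K^{q(2^{|expPad 1 u|} + |payload|)}(g ⟨expPad 1 (expPad 1 u), payload⟩) ≤ |payload| + 2|u| + c₀`: the string
is printed by the program `⟨e, ⟨u, payload⟩⟩` of the double ruler machine through the universality of
`U` (`sim`). Since `g` sees the ruler `1^{2^{2^{|u|}+|u|+1}}` (`expPad_one_expPad_one`), a time budget
`T` is available to `g` in unary as soon as `2^{2^{|u|}} ≥ T`, i.e. at the price of
`2|u| = 2⌈log₂ log₂ T⌉ + O(1)` description bits — the form "`+ O(log log t₁)`" of Hirahara's Lemma 4.19.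
[Hirahara 2018 (ECCC TR18-138), Lemma 4.19; Li–Vitányi, §7.1] [cite: Hirahara2018, Lemma 4.19] -/
theorem exists_ktAt_le_of_FP₂ {g : List Bool → List Bool} (hg : g ∈ FP) :
    ∃ (c₀ : ℕ) (q : Polynomial ℕ), ∀ u payload : List Bool,
      U.ktAt (q.eval (2 ^ (expPad 1 u).length + payload.length)) (g (boolPair (expPad 1 (expPad 1 u)) payload)) ≤
        payload.length + 2 * u.length + c₀ := by
  obtain ⟨M, A, B, hM⟩ := exists_outputsWithin_ruler₂ hg
  obtain ⟨e, p, hsim⟩ := U.exists_ktAt_le_of_outputsWithin M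
  refine ⟨2 * e.length + 4, p.comp (C A * X ^ B + C A), fun u payload => ?_⟩
  have h := hsim (boolPair u payload) _ _ (hM u payload)
  rw [eval_comp, eval_add, eval_mul, eval_C, eval_pow, eval_X]
  refine h.trans_eq ?_
  rw [length_boolPair]; push_cast; ring

/-- The same bound at any LARGER budget (antitonicity of `K^t` in the budget), in the form used
downstream: if `q(2^{|expPad 1 u|} + |payload|) ≤ t` then
`K^t(g ⟨expPad 1 (expPad 1 u), payload⟩) ≤ |payload| + 2|u| + c₀`. [cite: Hirahara2018, Lemma 4.19] -/
theorem exists_ktAt_le_of_FP₂' {g : List Bool → List Bool} (hg : g ∈ FP) :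
    ∃ (c₀ : ℕ) (q : Polynomial ℕ), ∀ (u payload : List Bool) (t : ℕ),
      q.eval (2 ^ (expPad 1 u).length + payload.length) ≤ t →
      U.ktAt t (g (boolPair (expPad 1 (expPad 1 u)) payload)) ≤ payload.length + 2 * u.length + c₀ := by
  obtain ⟨c₀, q, h⟩ := U.exists_ktAt_le_of_FP₂ hg
  exact ⟨c₀, q, fun u payload t ht => (U.ktAt_anti ht _).trans (h u payload)⟩

end UniversalMachine

end Literature.Computability.MetaComplexity
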